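import Summits.MatrixMultiplication.OmegaCensus.SmallFormats.MatMulM22Length3m3Frames
import HarnessLib

/-!
# ω-census family (a): CHEAP OUTPUT FUNCTIONALS from type-F excess (any field) — lemma (★) of tensor g38's LAW-3M3 memo

Cell `pub-omega` (unit `pub-omega-tensor`, gen 38), topic `Summits/MatrixMultiplication/OmegaCensus` (sub-folder
`SmallFormats`). Framing (verbatim): lottery ticket; floor = certified bounds/negative ranges. HONEST FRAMING: a structural lemma about
bilinear algorithms for `⟨m,2,2⟩` (equivalently `⟨2,2,m⟩`) over an ARBITRARY field; NEW mathematics of the cell; NOT a bound on any rank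
by itself; nothing here is a bound on `ω`.

## Statement (dictionary of `Literature/…/MatMulM22RankLowerBoundProofs.lean`)

Let `xy = ∑_t f_t(x) g_t(y) w_t` compute `⟨m,2,2⟩`, let `F` be an Alekseev frame (`J = Iᶜ`), and let `S` be a set of TYPE-F indices
(`p_t = 0`: the form `g_t` reads only the second column of `y`; census: the X-form lies in the rank-one plane of the direction). Then
(`exists_cheapFunctionals`) there is a subspace `C ⊆ k^m` with

  `dim C ≥ |S| + m − |J|`  and  `∑_i c_i w_t(i,1) = 0` for every `c ∈ C` and every `t ∉ S`:

for `c ∈ C` the output functional `xy ↦ cᵀ (xy) e₁` (census `⟨2,2,m⟩`: `XY ↦ u'ᵀ (XY) c`, `u'` the common column of the plane) is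
computed by the terms of `S` ALONE. At length `3m + 3`, `m ≥ 8` (`Frame3m3.card_J_le`: `|J| ≤ m + 2`) this is `dim C ≥ |S| − 2`
(`card_le_finrank_add_two`): a direction with `≥ 3` type-F indices carries a cheap output functional.

Proof: the vectors `α_i = (w_t(i,1))_t` (independent: `∑_t w_t(i,1) D_t^2 = P_i`) and the unit vectors `e_t`, `t ∈ S`, all lie in
`{z : ∑_t z_t D_t^1 = 0}` ((1) of the source: `∑_t w_t(i,1) D_t^1 = 0`; `D_t^1 = 0` for `t ∈ S`), on which the restriction to the
`J`-coordinates is injective (the `D_p^1`, `p ∈ I`, are independent); so `span{α_i} + span{e_t}` has dimension `≤ |J|` and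
`span{α_i} ∩ span{e_t : t ∈ S}` — whose preimage in `k^m` is `C` — has dimension `≥ m + |S| − |J|`. No minimality of the scheme is needed.
Desk check: tensor g38 `desk/starprobe.py` (the dimension is attained on the cell's GF(3) schemes).
-/

namespace Summit.MatrixMultiplication.OmegaCensus.SmallFormats

open Finset Module
open Literature.Computability.AlgebraicComplexity
open Literature.Computability.AlgebraicComplexity.Alekseev2015

namespace CheapFunctional

variable {k : Type*} [Field k] {m : ℕ} {ι : Type*} [Fintype ι] [DecidableEq ι]
variable {β : BilinComp (mulBilin k m 2 2) ι} (F : Frame β)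

omit [Fintype ι] in
/-- Members of the span of the unit vectors `e_t`, `t ∈ S`, vanish off `S`. -/
private theorem apply_eq_zero_of_mem_span_single (S : Finset ι) {z : ι → k}
    (hz : z ∈ Submodule.span k (Set.range fun t : ↥S => (Pi.single (t : ι) (1 : k) : ι → k))) :
    ∀ t, t ∉ S → z t = 0 := by
  induction hz using Submodule.span_induction with
  | mem x hx =>
    obtain ⟨s, rfl⟩ := hx
    intro t ht
    have hne : t ≠ (s : ι) := fun h => ht (h ▸ s.2)
    simp [hne]
  | zero => intro t _; rfl
  | add x y _ _ hx hy => intro t ht; simp [hx t ht, hy t ht]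
  | smul a x _ hx => intro t ht; simp [hx t ht]

/-- The unit vectors `e_t`, `t ∈ S`, span a space of dimension `|S|`. -/
private theorem finrank_span_single (S : Finset ι) :
    finrank k (Submodule.span k (Set.range fun t : ↥S => (Pi.single (t : ι) (1 : k) : ι → k))) = S.card := by
  have hli : LinearIndependent k (fun t : ↥S => (Pi.single (t : ι) (1 : k) : ι → k)) := by
    have h := (Pi.basisFun k ι).linearIndependent
    have h2 : LinearIndependent k (fun t : ↥S => (Pi.basisFun k ι) (t : ι)) :=
      h.comp (fun t : ↥S => (t : ι)) Subtype.val_injective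
    simpa [Pi.basisFun_apply] using h2
  rw [finrank_span_eq_card hli, Fintype.card_coe]

/-- **Cheap output functionals from type-F excess (any field).** For a frame `F` and a set `S` of type-F indices (`p_t = 0`) there is a
subspace `C ⊆ k^m` of dimension `≥ |S| + m − |J|` such that for every `c ∈ C` the output functional `xy ↦ cᵀ (xy) e₁` is computed by the
terms of `S` alone: `∑_i c_i w_t(i,1) = 0` for all `t ∉ S`. -/
theorem exists_cheapFunctionals (S : Finset ι) (hS : ∀ t ∈ S, pvec β t = 0) :
    ∃ C : Submodule k (Fin m → k),
      (∀ c ∈ C, ∀ t, t ∉ S → ∑ i, c i * β.w t i 1 = 0) ∧ S.card + m ≤ finrank k C + F.J.card := by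
  classical
  -- αmap : c ↦ (t ↦ ∑_i c_i w_t(i,1))
  let αmap : (Fin m → k) →ₗ[k] (ι → k) :=
    { toFun := fun c t => ∑ i, c i * β.w t i 1
      map_add' := fun c c' => by funext t; simp [add_mul, Finset.sum_add_distrib]
      map_smul' := fun a c => by funext t; simp [Finset.mul_sum, mul_assoc] }
  -- αmap is injective: ∑_t (αmap c)_t D²_t = ∑_i c_i P_i
  have hαD2 : ∀ c : Fin m → k, ∑ t, αmap c t • D2 β t = ∑ i, c i • rowMap k m i := by
    intro c
    have : ∀ t, αmap c t • D2 β t = ∑ i, (c i * β.w t i 1) • D2 β t := fun t => by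
      show (∑ i, c i * β.w t i 1) • D2 β t = _
      rw [Finset.sum_smul]
    rw [Finset.sum_congr rfl fun t _ => this t, Finset.sum_comm]
    refine Finset.sum_congr rfl fun i _ => ?_
    rw [← E4 β i, Finset.smul_sum]
    exact Finset.sum_congr rfl fun t _ => by rw [smul_smul]
  have hαinj : Function.Injective αmap := by
    rw [← LinearMap.ker_eq_bot, LinearMap.ker_eq_bot']
    intro c hc
    have h0 : ∑ i, c i • rowMap k m i = 0 := by
      rw [← hαD2 c]
      exact Finset.sum_eq_zero fun t _ => by rw [show αmap c t = 0 from congrFun hc t, zero_smul]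
    funext i
    exact (Fintype.linearIndependent_iff.1 (linearIndependent_rowMap (k := k) (m := m)) c h0) i
  -- the spaces
  let Mα : Submodule k (ι → k) := LinearMap.range αmap
  let MS : Submodule k (ι → k) := Submodule.span k (Set.range fun t : ↥S => (Pi.single (t : ι) (1 : k) : ι → k))
  let KI : Submodule k (ι → k) := Submodule.span k (Set.range fun p : ↥F.I => (Pi.single (p : ι) (1 : k) : ι → k))
  have hMα : finrank k Mα = m := by
    show finrank k (LinearMap.range αmap) = m
    rw [LinearMap.finrank_range_of_inj hαinj, Module.finrank_fintype_fun_eq_card, Fintype.card_fin]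
  have hMS : finrank k MS = S.card := finrank_span_single S
  have hKI : finrank k KI = F.I.card := finrank_span_single F.I
  -- every z ∈ Mα ⊔ MS is a relation among the first blocks
  have hrel : ∀ z ∈ Mα ⊔ MS, ∑ t, z t • D1 β t = 0 := by
    intro z hz
    obtain ⟨x, hx, y, hy, rfl⟩ := Submodule.mem_sup.1 hz
    have hx0 : ∑ t, x t • D1 β t = 0 := by
      obtain ⟨c, rfl⟩ := LinearMap.mem_range.1 hx
      have : ∀ t, αmap c t • D1 β t = ∑ i, (c i * β.w t i 1) • D1 β t := fun t => by
        show (∑ i, c i * β.w t i 1) • D1 β t = _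
        rw [Finset.sum_smul]
      rw [Finset.sum_congr rfl fun t _ => this t, Finset.sum_comm]
      refine Finset.sum_eq_zero fun i _ => ?_
      have h3 := E3 β i
      rw [show ∑ t, (c i * β.w t i 1) • D1 β t = c i • ∑ t, β.w t i 1 • D1 β t by
        rw [Finset.smul_sum]; exact Finset.sum_congr rfl fun t _ => by rw [smul_smul], h3, smul_zero]
    have hy0 : ∑ t, y t • D1 β t = 0 := by
      -- y is supported on S, where D¹ vanishes
      have hyS := apply_eq_zero_of_mem_span_single S hy
      refine Finset.sum_eq_zero fun t _ => ?_
      by_cases ht : t ∈ S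
      · have hD : D1 β t = 0 := by ext x; simp [hS t ht]
        rw [hD, smul_zero]
      · rw [hyS t ht, zero_smul]
    simp only [Pi.add_apply, add_smul, Finset.sum_add_distrib, hx0, hy0, add_zero]
  -- … so it meets the coordinate space of I trivially
  have hinf : (Mα ⊔ MS) ⊓ KI = ⊥ := by
    rw [eq_bot_iff]
    intro z hz
    obtain ⟨hz1, hz2⟩ := Submodule.mem_inf.1 hz
    have hzI := apply_eq_zero_of_mem_span_single F.I hz2
    have hsum : ∑ p ∈ F.I, z p • D1 β p = 0 := by
      rw [← hrel z hz1, ← Finset.sum_subset (Finset.subset_univ F.I)]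
      intro t _ ht
      rw [hzI t ht, zero_smul]
    have hzero := F.indep z hsum
    rw [Submodule.mem_bot]
    funext t
    by_cases ht : t ∈ F.I
    · exact hzero t ht
    · exact hzI t ht
  have hdimN : finrank k ↥(Mα ⊔ MS) ≤ F.J.card := by
    have h1 := Submodule.finrank_sup_add_finrank_inf_eq (Mα ⊔ MS) KI
    rw [hinf, finrank_bot, hKI] at h1
    have h2 : finrank k ↥((Mα ⊔ MS) ⊔ KI) ≤ finrank k (ι → k) := Submodule.finrank_le _
    rw [Module.finrank_fintype_fun_eq_card] at h2
    have h3 := F.card_I_add_card_J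
    omega
  have hdimI : S.card + m ≤ finrank k ↥(Mα ⊓ MS) + F.J.card := by
    have h1 := Submodule.finrank_sup_add_finrank_inf_eq Mα MS
    rw [hMα, hMS] at h1
    omega
  -- C := the preimage of MS
  refine ⟨Submodule.comap αmap MS, fun c hc t ht => ?_, ?_⟩
  · have hmem : αmap c ∈ MS := hc
    exact apply_eq_zero_of_mem_span_single S hmem t ht
  · have hmap : Submodule.map αmap (Submodule.comap αmap MS) = Mα ⊓ MS := Submodule.map_comap_eq αmap MS
    have h1 : finrank k ↥(Mα ⊓ MS) ≤ finrank k ↥(Submodule.comap αmap MS) := by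
      rw [← hmap]
      exact Submodule.finrank_map_le αmap _
    omega

/-- **At length `3m + 3`, `m ≥ 8`: `dim C ≥ |S| − 2`** (with `Frame3m3.card_J_le`: `|J| ≤ m + 2`). In particular three type-F indices in
one direction give a non-zero `c` whose output functional `xy ↦ cᵀ (xy) e₁` is computed by those (at most four) terms alone. -/
theorem card_le_finrank_add_two (β : BilinComp (mulBilin k m 2 2) ι) (hm : 8 ≤ m) (hι : Fintype.card ι ≤ 3 * m + 3)
    (S : Finset ι) (hS : ∀ t ∈ S, pvec β t = 0) :
    ∃ C : Submodule k (Fin m → k),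
      (∀ c ∈ C, ∀ t, t ∉ S → ∑ i, c i * β.w t i 1 = 0) ∧ S.card ≤ finrank k C + 2 := by
  obtain ⟨F⟩ := exists_frame β
  obtain ⟨C, hC, hdim⟩ := exists_cheapFunctionals F S hS
  have hJ := Frame3m3.card_J_le F hm hι
  exact ⟨C, hC, by omega⟩

end CheapFunctional

end Summit.MatrixMultiplication.OmegaCensus.SmallFormats
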